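import Summits.RiemannHypothesis.RiemannHypothesis.Theorems.SoloInformedFenceInvisibility

/-!
# Period pieces and the polarized Parseval identity without a support condition

(solo RiemannHypothesis/informed, session 4; harmonic-analysis half of the "anatomy of fence visibility",
`SoloInformedFenceAnatomy`.)

For `F, G : ℝ → ℂ` continuous with supports in `[−a, a]` and ANY period `T > 0` with `a ≤ N·T`, the
samples `X_F(k) = ∫ F(t) e^{2πikt/T} dt` satisfy

  `Σ_k Re(X_F(k)·conj X_G(k)) = T · Σ_{|d| ≤ 2N} ∫ Re(F(s)·conj G(s + dT)) ds`

(`hasSum_re_integral_mul_conj_integral_lags`).  Proof: cut `ℝ` into the `2N+1` period pieces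
`((i−N)T − T/2, (i−N)T + T/2]`, translate each to the base period (the samples are invariant,
`cexp_sample_add_int_mul`), apply the polarized Parseval identity on the base period
(`hasSum_re_intervalIntegral_mul_conj`, from `hasSum_sq_fourierCoeffOn`) to every pair of pieces,
and regroup the double sum by the lag `d = j − i` (`sum_pieces_eq_sum_lags`).  Pure harmonic
analysis; no property of `ζ` is used.
-/

open Complex MeasureTheory Set Filter
open Literature.NumberTheory.LFunctions
open scoped ComplexConjugate Real

namespace Summit.RiemannHypothesis.RiemannHypothesis.Theorems

section PeriodPieces

variable {h : ℝ → ℂ} {a T : ℝ}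

/-! ### Period pieces -/

/-- The samples `e^{2πikt/T}` are invariant under translation by integer multiples of `T`. -/
theorem cexp_sample_add_int_mul (hT : T ≠ 0) (k m : ℤ) (s : ℝ) :
    cexp ((2 * π * k / T : ℝ) * I * ((s + m * T : ℝ) : ℂ)) = cexp ((2 * π * k / T : ℝ) * I * s) := by
  have hT' : (T : ℂ) ≠ 0 := Complex.ofReal_ne_zero.mpr hT
  have e : ((2 * π * k / T : ℝ) : ℂ) * I * ((s + m * T : ℝ) : ℂ) =
      ((2 * π * k / T : ℝ) : ℂ) * I * s + ((k * m : ℤ) : ℂ) * (2 * π * I) := by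
    push_cast
    field_simp
  rw [e, Complex.exp_add, Complex.exp_int_mul_two_pi_mul_I, mul_one]

/-- Cutting `ℝ` into `2N+1` period pieces: for `f` continuous with `supp f ⊆ [−a, a]`, `a ≤ N·T`,
`∫ f = Σ_{i<2N+1} ∫_{−T/2}^{T/2} f(t + (i − N)T) dt`. -/
theorem integral_eq_sum_period_pieces {E : Type*} [NormedAddCommGroup E] [NormedSpace ℝ E]
    [CompleteSpace E] {f : ℝ → E} (hT : 0 < T) (N : ℕ) (haN : a ≤ N * T)
    (hf : Continuous f) (hf0 : Function.support f ⊆ Icc (-a) a) :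
    ∫ t : ℝ, f t = ∑ i ∈ Finset.range (2 * N + 1),
      ∫ t in (-(T / 2))..(T / 2), f (t + ((i : ℝ) - N) * T) := by
  set b : ℕ → ℝ := fun i ↦ -((N : ℝ) + 1 / 2) * T + i * T with hb
  have hadj := intervalIntegral.sum_integral_adjacent_intervals (μ := volume) (a := b)
    (n := 2 * N + 1) (f := f) (fun i _ ↦ hf.intervalIntegrable _ _)
  have hsupp : Function.support f ⊆ Ioc (b 0) (b (2 * N + 1)) := by
    intro x hx
    have hx' := hf0 hx
    simp only [hb, mem_Ioc]
    push_cast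
    constructor <;> nlinarith [hx'.1, hx'.2, hT]
  rw [← intervalIntegral.integral_eq_integral_of_support_subset hsupp, ← hadj]
  refine Finset.sum_congr rfl fun i _ ↦ ?_
  rw [intervalIntegral.integral_comp_add_right f (((i : ℝ) - N) * T)]
  simp only [hb]
  congr 1 <;> push_cast <;> ring

/-! ### Polarized Parseval on the base period (no support condition) -/

/-- `T·ĉ_{−k}(P) = ∫_{−T/2}^{T/2} P(t)e^{2πikt/T}dt` for the Fourier coefficients on the base
period. -/
theorem intervalIntegral_cexp_mul_eq_mul_fourierCoeffOn {P : ℝ → ℂ} (hT : 0 < T) (k : ℤ) :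
    ∫ t in (-(T / 2))..(T / 2), cexp ((2 * π * k / T : ℝ) * I * t) * P t =
      (T : ℂ) * fourierCoeffOn (show -(T / 2) < T / 2 by linarith) P (-k) := by
  rw [fourierCoeffOn_eq_integral, neg_neg, Complex.real_smul]
  have hTT : (1 / (T / 2 - -(T / 2)) : ℝ) = T⁻¹ := by
    rw [show T / 2 - -(T / 2) = T by ring, one_div]
  rw [hTT, ← mul_assoc, Complex.ofReal_inv, mul_inv_cancel₀ (Complex.ofReal_ne_zero.mpr hT.ne'),
    one_mul]
  refine intervalIntegral.integral_congr fun x _ ↦ ?_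
  rw [fourier_coe_apply, smul_eq_mul]
  congr 2
  push_cast
  ring

/-- Parseval on the base period for a continuous compactly supported `P` (no condition on where the
support lies): `Σ_k |∫_{−T/2}^{T/2} P e^{2πikt/T}|² = T·∫_{−T/2}^{T/2}|P|²`. -/
theorem hasSum_norm_sq_intervalIntegral_cexp_mul {P : ℝ → ℂ} (hT : 0 < T) (hP : Continuous P)
    (hPc : HasCompactSupport P) :
    HasSum (fun k : ℤ ↦ ‖∫ t in (-(T / 2))..(T / 2), cexp ((2 * π * k / T : ℝ) * I * t) * P t‖ ^ 2)
      (T * ∫ t in (-(T / 2))..(T / 2), ‖P t‖ ^ 2) := by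
  have hab : -(T / 2) < T / 2 := by linarith
  have hL2 : MemLp P 2 (volume.restrict (Ioc (-(T / 2)) (T / 2))) :=
    (hP.memLp_of_hasCompactSupport hPc).restrict _
  have hPar := hasSum_sq_fourierCoeffOn hab hL2
  rw [show T / 2 - -(T / 2) = T by ring, smul_eq_mul] at hPar
  have hP2 := hPar.mul_left (T ^ 2)
  have hval : T ^ 2 * (T⁻¹ * ∫ t in (-(T / 2))..(T / 2), ‖P t‖ ^ 2) =
      T * ∫ t in (-(T / 2))..(T / 2), ‖P t‖ ^ 2 := by
    rw [← mul_assoc, pow_two, mul_assoc T T T⁻¹, mul_inv_cancel₀ hT.ne', mul_one]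
  rw [hval] at hP2
  have hP3 := (Equiv.hasSum_iff (Equiv.neg ℤ)).mpr hP2
  have e : (fun k : ℤ ↦ ‖∫ t in (-(T / 2))..(T / 2), cexp ((2 * π * k / T : ℝ) * I * t) * P t‖ ^ 2) =
      (fun i : ℤ ↦ T ^ 2 * ‖fourierCoeffOn hab P i‖ ^ 2) ∘ ⇑(Equiv.neg ℤ) := by
    funext k
    rw [Function.comp_apply, Equiv.neg_apply, intervalIntegral_cexp_mul_eq_mul_fourierCoeffOn hT k,
      norm_mul, Complex.norm_real, Real.norm_eq_abs, mul_pow, sq_abs]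
  rw [e]
  exact hP3

/-- Polarized Parseval on the base period: `Σ_k Re((∫P e_k)(conj ∫Q e_k)) = T·∫_{−T/2}^{T/2} Re(P·Q̄)`. -/
theorem hasSum_re_intervalIntegral_mul_conj {P Q : ℝ → ℂ} (hT : 0 < T) (hP : Continuous P)
    (hPc : HasCompactSupport P) (hQ : Continuous Q) (hQc : HasCompactSupport Q) :
    HasSum (fun k : ℤ ↦ ((∫ t in (-(T / 2))..(T / 2), cexp ((2 * π * k / T : ℝ) * I * t) * P t) *
        conj (∫ t in (-(T / 2))..(T / 2), cexp ((2 * π * k / T : ℝ) * I * t) * Q t)).re)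
      (T * ∫ t in (-(T / 2))..(T / 2), (P t * conj (Q t)).re) := by
  have hA := hasSum_norm_sq_intervalIntegral_cexp_mul (P := fun t ↦ P t + Q t) hT (hP.add hQ)
    (hPc.add hQc)
  have hB := hasSum_norm_sq_intervalIntegral_cexp_mul (P := fun t ↦ P t - Q t) hT (hP.sub hQ)
    (hPc.sub hQc)
  have hint : ∀ (k : ℤ) (H : ℝ → ℂ), Continuous H →
      IntervalIntegrable (fun t : ℝ ↦ cexp ((2 * π * k / T : ℝ) * I * t) * H t) volume
        (-(T / 2)) (T / 2) := by
    intro k H hH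
    exact ((Complex.continuous_exp.comp (by fun_prop)).mul hH).intervalIntegrable _ _
  have hS := (hA.sub hB).div_const 4
  have e1 : (fun k : ℤ ↦ ((∫ t in (-(T / 2))..(T / 2), cexp ((2 * π * k / T : ℝ) * I * t) * P t) *
        conj (∫ t in (-(T / 2))..(T / 2), cexp ((2 * π * k / T : ℝ) * I * t) * Q t)).re) =
      fun k : ℤ ↦ (‖∫ t in (-(T / 2))..(T / 2), cexp ((2 * π * k / T : ℝ) * I * t) * (P t + Q t)‖ ^ 2 -
        ‖∫ t in (-(T / 2))..(T / 2), cexp ((2 * π * k / T : ℝ) * I * t) * (P t - Q t)‖ ^ 2) / 4 := by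
    funext k
    rw [re_mul_conj_eq_norm_sq]
    simp only [mul_add, mul_sub]
    rw [intervalIntegral.integral_add (hint k P hP) (hint k Q hQ),
      intervalIntegral.integral_sub (hint k P hP) (hint k Q hQ)]
  have hpt : (fun t : ℝ ↦ ‖P t + Q t‖ ^ 2 - ‖P t - Q t‖ ^ 2) =
      fun t : ℝ ↦ (4 : ℝ) * (P t * conj (Q t)).re := by
    funext t
    rw [re_mul_conj_eq_norm_sq]
    ring
  have e2 : ((T * ∫ t in (-(T / 2))..(T / 2), ‖P t + Q t‖ ^ 2) -
        T * ∫ t in (-(T / 2))..(T / 2), ‖P t - Q t‖ ^ 2) / 4 =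
      T * ∫ t in (-(T / 2))..(T / 2), (P t * conj (Q t)).re := by
    have i1 : IntervalIntegrable (fun t : ℝ ↦ ‖P t + Q t‖ ^ 2) volume (-(T / 2)) (T / 2) :=
      (show Continuous (fun t : ℝ ↦ ‖P t + Q t‖ ^ 2) by fun_prop).intervalIntegrable _ _
    have i2 : IntervalIntegrable (fun t : ℝ ↦ ‖P t - Q t‖ ^ 2) volume (-(T / 2)) (T / 2) :=
      (show Continuous (fun t : ℝ ↦ ‖P t - Q t‖ ^ 2) by fun_prop).intervalIntegrable _ _
    rw [← mul_sub, ← intervalIntegral.integral_sub i1 i2, hpt, intervalIntegral.integral_const_mul]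
    ring
  rw [e1, ← e2]
  exact hS

/-! ### The fence sum for general windows: double-sum and lag forms -/

/-- Piece decomposition of the samples: for `F` continuous with `supp F ⊆ [−a,a]`, `a ≤ NT`,
`∫ F e_k = Σ_{i<2N+1} ∫_{−T/2}^{T/2} e_k(t) F(t + (i−N)T) dt`. -/
theorem integral_cexp_mul_eq_sum_pieces {F : ℝ → ℂ} (hT : 0 < T) (N : ℕ) (haN : a ≤ N * T)
    (hF : Continuous F) (hF0 : Function.support F ⊆ Icc (-a) a) (k : ℤ) :
    ∫ t : ℝ, cexp ((2 * π * k / T : ℝ) * I * t) * F t = ∑ i ∈ Finset.range (2 * N + 1),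
      ∫ t in (-(T / 2))..(T / 2), cexp ((2 * π * k / T : ℝ) * I * t) * F (t + ((i : ℝ) - N) * T) := by
  have hc : Continuous fun t : ℝ ↦ cexp ((2 * π * k / T : ℝ) * I * t) * F t :=
    (Complex.continuous_exp.comp (by fun_prop)).mul hF
  have hs : Function.support (fun t : ℝ ↦ cexp ((2 * π * k / T : ℝ) * I * t) * F t) ⊆ Icc (-a) a := by
    intro x hx
    apply hF0
    rw [Function.mem_support] at hx ⊢
    intro h0
    exact hx (by rw [h0, mul_zero])
  rw [integral_eq_sum_period_pieces hT N haN hc hs]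
  refine Finset.sum_congr rfl fun i _ ↦ ?_
  refine intervalIntegral.integral_congr fun t _ ↦ ?_
  rw [show t + ((i : ℝ) - N) * T = t + (((i : ℤ) - N : ℤ) : ℝ) * T by push_cast; ring,
    cexp_sample_add_int_mul hT.ne' k _ t]

/-- **General fence sum, double-sum form.** For `F, G` continuous with supports in `[−a,a]`,
`a ≤ NT`: `Σ_k Re((∫F e_k)(conj ∫G e_k)) = T·Σ_{i,j<2N+1} ∫_{−T/2}^{T/2} Re(F(t+(i−N)T)·conj G(t+(j−N)T))dt`. -/
theorem hasSum_re_integral_mul_conj_integral_pieces {F G : ℝ → ℂ} (hT : 0 < T) (N : ℕ)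
    (haN : a ≤ N * T) (hF : Continuous F) (hFc : HasCompactSupport F)
    (hF0 : Function.support F ⊆ Icc (-a) a) (hG : Continuous G) (hGc : HasCompactSupport G)
    (hG0 : Function.support G ⊆ Icc (-a) a) :
    HasSum (fun k : ℤ ↦ ((∫ t : ℝ, cexp ((2 * π * k / T : ℝ) * I * t) * F t) *
        conj (∫ t : ℝ, cexp ((2 * π * k / T : ℝ) * I * t) * G t)).re)
      (T * ∑ i ∈ Finset.range (2 * N + 1), ∑ j ∈ Finset.range (2 * N + 1),
        ∫ t in (-(T / 2))..(T / 2),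
          (F (t + ((i : ℝ) - N) * T) * conj (G (t + ((j : ℝ) - N) * T))).re) := by
  have hcF : ∀ c : ℝ, Continuous fun t : ℝ ↦ F (t + c) := fun c ↦ by fun_prop
  have hcG : ∀ c : ℝ, Continuous fun t : ℝ ↦ G (t + c) := fun c ↦ by fun_prop
  have hkF : ∀ c : ℝ, HasCompactSupport fun t : ℝ ↦ F (t + c) :=
    fun c ↦ hFc.comp_homeomorph (Homeomorph.addRight c)
  have hkG : ∀ c : ℝ, HasCompactSupport fun t : ℝ ↦ G (t + c) :=
    fun c ↦ hGc.comp_homeomorph (Homeomorph.addRight c)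
  have hij : ∀ i j : ℕ, HasSum (fun k : ℤ ↦
      ((∫ t in (-(T / 2))..(T / 2), cexp ((2 * π * k / T : ℝ) * I * t) * F (t + ((i : ℝ) - N) * T)) *
        conj (∫ t in (-(T / 2))..(T / 2),
          cexp ((2 * π * k / T : ℝ) * I * t) * G (t + ((j : ℝ) - N) * T))).re)
      (T * ∫ t in (-(T / 2))..(T / 2),
        (F (t + ((i : ℝ) - N) * T) * conj (G (t + ((j : ℝ) - N) * T))).re) :=
    fun i j ↦ hasSum_re_intervalIntegral_mul_conj hT (hcF _) (hkF _) (hcG _) (hkG _)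
  have hsum := hasSum_sum (s := Finset.range (2 * N + 1)) fun i _ ↦
    hasSum_sum (s := Finset.range (2 * N + 1)) fun j _ ↦ hij i j
  have e1 : (fun k : ℤ ↦ ((∫ t : ℝ, cexp ((2 * π * k / T : ℝ) * I * t) * F t) *
        conj (∫ t : ℝ, cexp ((2 * π * k / T : ℝ) * I * t) * G t)).re) =
      fun k : ℤ ↦ ∑ i ∈ Finset.range (2 * N + 1), ∑ j ∈ Finset.range (2 * N + 1),
        ((∫ t in (-(T / 2))..(T / 2),
            cexp ((2 * π * k / T : ℝ) * I * t) * F (t + ((i : ℝ) - N) * T)) *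
          conj (∫ t in (-(T / 2))..(T / 2),
            cexp ((2 * π * k / T : ℝ) * I * t) * G (t + ((j : ℝ) - N) * T))).re := by
    funext k
    rw [integral_cexp_mul_eq_sum_pieces hT N haN hF hF0 k,
      integral_cexp_mul_eq_sum_pieces hT N haN hG hG0 k, map_sum, Finset.sum_mul, Complex.re_sum]
    refine Finset.sum_congr rfl fun i _ ↦ ?_
    rw [Finset.mul_sum, Complex.re_sum]
  have e2 : (T * ∑ i ∈ Finset.range (2 * N + 1), ∑ j ∈ Finset.range (2 * N + 1),
        ∫ t in (-(T / 2))..(T / 2),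
          (F (t + ((i : ℝ) - N) * T) * conj (G (t + ((j : ℝ) - N) * T))).re) =
      ∑ i ∈ Finset.range (2 * N + 1), ∑ j ∈ Finset.range (2 * N + 1),
        T * ∫ t in (-(T / 2))..(T / 2),
          (F (t + ((i : ℝ) - N) * T) * conj (G (t + ((j : ℝ) - N) * T))).re := by
    rw [Finset.mul_sum]
    refine Finset.sum_congr rfl fun i _ ↦ ?_
    rw [Finset.mul_sum]
  rw [e1, e2]
  exact hsum

/-- Regrouping the double sum over pieces by the lag `d = j − i`: the `(i,j)` term is the integral of
`s ↦ Re(F(s)·conj G(s + dT))` over piece `i`, terms with `i + d ∉ [0, 2N]` vanish, and the pieces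
reassemble to integrals over `ℝ`. -/
theorem sum_pieces_eq_sum_lags {F G : ℝ → ℂ} (hT : 0 < T) (N : ℕ) (haN : a ≤ N * T)
    (hF : Continuous F) (hF0 : Function.support F ⊆ Icc (-a) a) (hG : Continuous G)
    (hG0 : Function.support G ⊆ Icc (-a) a) :
    (∑ i ∈ Finset.range (2 * N + 1), ∑ j ∈ Finset.range (2 * N + 1),
        ∫ t in (-(T / 2))..(T / 2),
          (F (t + ((i : ℝ) - N) * T) * conj (G (t + ((j : ℝ) - N) * T))).re) =
      ∑ d ∈ Finset.Icc (-(2 * N : ℤ)) (2 * N),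
        ∫ s : ℝ, (F s * conj (G (s + d * T))).re := by
  -- Φ d s := Re(F s · conj G(s + dT)); g i d := ∫_{base} Φ d (t + (i−N)T)
  set Φ : ℤ → ℝ → ℝ := fun d s ↦ (F s * conj (G (s + d * T))).re with hΦ
  have hΦc : ∀ d : ℤ, Continuous (Φ d) := fun d ↦
    Complex.continuous_re.comp (hF.mul (Complex.continuous_conj.comp (show Continuous (fun s : ℝ ↦ G (s + d * T)) by fun_prop)))
  have hΦ0 : ∀ d : ℤ, Function.support (Φ d) ⊆ Icc (-a) a := by
    intro d x hx
    apply hF0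
    rw [Function.mem_support] at hx ⊢
    intro h0
    apply hx
    simp only [hΦ, h0, zero_mul, Complex.zero_re]
  -- step 1: rewrite the (i,j) term as g i (j - i)
  have step1 : ∀ i j : ℕ, (∫ t in (-(T / 2))..(T / 2),
      (F (t + ((i : ℝ) - N) * T) * conj (G (t + ((j : ℝ) - N) * T))).re) =
      ∫ t in (-(T / 2))..(T / 2), Φ ((j : ℤ) - i) (t + ((i : ℝ) - N) * T) := by
    intro i j
    refine intervalIntegral.integral_congr fun t _ ↦ ?_
    simp only [hΦ]
    congr 4
    push_cast
    ring
  -- step 2: vanishing of g i d when i + d ∉ [0, 2N]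
  have step2 : ∀ (i : ℕ) (d : ℤ), i < 2 * N + 1 → ((i : ℤ) + d < 0 ∨ (2 * N : ℤ) < i + d) →
      (∫ t in (-(T / 2))..(T / 2), Φ d (t + ((i : ℝ) - N) * T)) = 0 := by
    intro i d hi hd
    refine intervalIntegral.integral_zero_ae (Eventually.of_forall fun t ht ↦ ?_)
    have ht' : -(T / 2) ≤ t ∧ t ≤ T / 2 := by
      rw [uIoc_of_le (by linarith)] at ht
      exact ⟨ht.1.le, ht.2⟩
    simp only [hΦ]
    have hGz : G (t + ((i : ℝ) - N) * T + d * T) = 0 := by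
      by_contra hne
      have hmem := hG0 (Function.mem_support.mpr hne)
      rcases hd with hd | hd
      · have hd' : ((i : ℝ) + d) ≤ -1 := by exact_mod_cast (show (i : ℤ) + d ≤ -1 by omega)
        have : t + ((i : ℝ) - N) * T + d * T ≤ T / 2 + (-1 - N) * T := by nlinarith [ht'.2, hT]
        nlinarith [hmem.1, hT]
      · have hd' : (2 * N + 1 : ℝ) ≤ (i : ℝ) + d := by exact_mod_cast (show (2 * N + 1 : ℤ) ≤ i + d by omega)
        have : -(T / 2) + (N + 1) * T ≤ t + ((i : ℝ) - N) * T + d * T := by nlinarith [ht'.1, hT]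
        nlinarith [hmem.2, hT]
    rw [hGz, map_zero, mul_zero, Complex.zero_re]
  -- step 3: for each i, the j-sum equals the d-sum over Icc (-2N) (2N)
  have step3 : ∀ i ∈ Finset.range (2 * N + 1),
      (∑ j ∈ Finset.range (2 * N + 1), ∫ t in (-(T / 2))..(T / 2),
          (F (t + ((i : ℝ) - N) * T) * conj (G (t + ((j : ℝ) - N) * T))).re) =
      ∑ d ∈ Finset.Icc (-(2 * N : ℤ)) (2 * N),
        ∫ t in (-(T / 2))..(T / 2), Φ d (t + ((i : ℝ) - N) * T) := by
    intro i hi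
    rw [Finset.mem_range] at hi
    simp_rw [step1 i]
    -- reindex j ↦ d = j - i
    have hinj : Set.InjOn (fun j : ℕ ↦ (j : ℤ) - i) (Finset.range (2 * N + 1) : Set ℕ) := by
      intro x _ y _ hxy
      have : (x : ℤ) = y := by simpa using hxy
      exact_mod_cast this
    rw [← Finset.sum_image (f := fun d : ℤ ↦ ∫ t in (-(T / 2))..(T / 2), Φ d (t + ((i : ℝ) - N) * T))
      hinj]
    apply Finset.sum_subset
    · intro d hd
      rw [Finset.mem_image] at hd
      obtain ⟨j, hj, rfl⟩ := hd
      rw [Finset.mem_range] at hj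
      rw [Finset.mem_Icc]
      constructor <;> omega
    · intro d hd hnot
      rw [Finset.mem_Icc] at hd
      apply step2 i d hi
      by_cases h1 : (i : ℤ) + d < 0
      · exact Or.inl h1
      by_cases h2 : (2 * N : ℤ) < i + d
      · exact Or.inr h2
      exfalso
      apply hnot
      rw [Finset.mem_image]
      refine ⟨((i : ℤ) + d).toNat, ?_, ?_⟩
      · rw [Finset.mem_range]; omega
      · exact (by omega : ((((i : ℤ) + d).toNat : ℕ) : ℤ) - (i : ℤ) = d)
  rw [Finset.sum_congr rfl step3, Finset.sum_comm]
  refine Finset.sum_congr rfl fun d _ ↦ ?_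
  rw [integral_eq_sum_period_pieces hT N haN (hΦc d) (hΦ0 d)]

/-- **General fence sum, lag form.** For `F, G` continuous with supports in `[−a, a]`, `a ≤ NT`:
`Σ_k Re((∫F e_k)(conj ∫G e_k)) = T·Σ_{|d|≤2N} ∫ Re(F(s)·conj G(s + dT)) ds`. -/
theorem hasSum_re_integral_mul_conj_integral_lags {F G : ℝ → ℂ} (hT : 0 < T) (N : ℕ)
    (haN : a ≤ N * T) (hF : Continuous F) (hFc : HasCompactSupport F)
    (hF0 : Function.support F ⊆ Icc (-a) a) (hG : Continuous G) (hGc : HasCompactSupport G)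
    (hG0 : Function.support G ⊆ Icc (-a) a) :
    HasSum (fun k : ℤ ↦ ((∫ t : ℝ, cexp ((2 * π * k / T : ℝ) * I * t) * F t) *
        conj (∫ t : ℝ, cexp ((2 * π * k / T : ℝ) * I * t) * G t)).re)
      (T * ∑ d ∈ Finset.Icc (-(2 * N : ℤ)) (2 * N), ∫ s : ℝ, (F s * conj (G (s + d * T))).re) := by
  rw [← sum_pieces_eq_sum_lags hT N haN hF hF0 hG hG0]
  exact hasSum_re_integral_mul_conj_integral_pieces hT N haN hF hFc hF0 hG hGc hG0

end PeriodPieces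

end Summit.RiemannHypothesis.RiemannHypothesis.Theorems
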